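import Summits.AnomalousDissipation.AnomalousDissipation.Theorems.SawtoothPulseCascadeK1LocalisedCascadeOscFatSegment
import Summits.AnomalousDissipation.AnomalousDissipation.Theorems.SawtoothPulseCascadeK1LocalisedCascadeOscJunction11
import Summits.AnomalousDissipation.AnomalousDissipation.Theorems.SawtoothPulseCascadeK1LocalisedCascadeTailClose
import Summits.AnomalousDissipation.AnomalousDissipation.Theorems.SawtoothPulseCascadeK1LocalisedCascadeDatumSpectrum

/-!
# K1loc′ FROM THE PHASE-4 INPUTS: the certified Osc segment (phases 4…10), the junction (phase 11) and the thin tail (phases ≥ 12)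

Prover lane on the crux `K1LocalisedCascade` (stmt-AnomalousDissipation-19491), route `SawtoothPulseCascade`
(S-B/S-C assembly seat; the LEDGER ASSEMBLY of K1loc′, `γ = 8`, `0 < δ₀ ≤ 2⁻¹⁰⁰`, shape `(d, N₀, ρ_N) = (2, 1, 2)`).  Composition of
`…OscFatSegment.fat_segment_osc_le_11` (`E₁₁ ≤ E₄ + 0.1453 + 0.2488·o₄`, `o₁₁ ≤ 0.0036`), `…OscJunction11.junction_step_phase11`
(`E₁₂^wide ≤ E₁₁ + 0.0032 + 0.0002·o₁₁`, `o₁₂ ≤ 0.0558`) and `…TailClose.k1Localised_of_phase12` (tail budget `0.0033`) with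
`‖datum‖² = 1/2` (`K1Start.scalarL2Sq_datum`):
  **`k1Localised_of_phase4`**: if the iterates satisfy `S₄(500000) + O₄(500000) ≤ E₄`, `√O₄(500000) ≤ o₄` (class `|k₀| ≤ 4|k₁|`) with
  `E₄ + 0.2488·o₄ ≤ 0.348`, then `K1Localised P (γ² − 3)`.
What remains for K1loc′ is the START (phases 0…3, owner p3): numbers `E₄`, `o₄` with `E₄ + 0.2488·o₄ ≤ 0.348` (e.g. `E₄ ≤ 0.22`,
`o₄ ≤ 0.5`).  No definitions; no statement about the crux itself (whose `δ₀ = 1/4` is out of reach of this window technology).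
[cite: DEIJ2022, (1.2)–(1.3)] [cite: Grafakos2014, Prop. 3.2.7 (3)] [problem: turb]
-/

-- `Summit.<Summit>.<Problem>`: single-conjunct summit, the duplicate namespace segment is deliberate.
set_option linter.dupNamespace false

noncomputable section

namespace Summit.AnomalousDissipation.AnomalousDissipation.Theorems.SawtoothPulseCascade.K1Window

open MeasureTheory Set Filter Topology UnitAddTorus Function Complex Metric
open scoped Real ENNReal
open Literature.Analysis Literature.Analysis.FunctionSpaces Literature.Analysis.FunctionSpaces.Torus Literature.Analysis.FluidPDE
open Literature.Analysis.FluidPDE.ShearStage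
open Literature.Analysis.FluidPDE.SawtoothCascade Literature.Analysis.FluidPDE.SawtoothCascade.CascadeParams
open Summit.AnomalousDissipation.AnomalousDissipation.Theorems.SawtoothPulseCascade.K1Start
open Summit.AnomalousDissipation.AnomalousDissipation.Theorems.SawtoothPulseCascade.K1Flat
open Summit.AnomalousDissipation.AnomalousDissipation.Theorems.SawtoothPulseCascade.K1Ledger.From

section Cascade

variable (P : CascadeParams)

/-- **K1loc′ FROM THE PHASE-4 INPUTS** (see the file header): `S₄ + O₄ ≤ E₄`, `√O₄ ≤ o₄`, `E₄ + 0.2488·o₄ ≤ 0.348` give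
`K1Localised P (γ² − 3)` for `γ = 8`, `0 < δ₀ ≤ 2⁻¹⁰⁰`. [cite: DEIJ2022, (1.2)–(1.3)] [cite: Grafakos2014, Prop. 3.2.7 (3)] -/
theorem k1Localised_of_phase4 (hγ : P.γ = 8) (hδ₀ : 0 < P.δ₀) (hδ₀' : P.δ₀ ≤ (2 : ℝ)⁻¹ ^ 100) (hd : P.d = 2) (hN₀ : P.N₀ = 1)
    (hρN : P.ρN = 2) (a b : ℕ → UnitAddTorus (Fin 2) → ℝ) (has : ∀ j, IsSmooth (a j)) (h0 : a 0 = datum)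
    (hb : ∀ j, b j = a j ∘ shearMap 0 1 (amp ⟨P.U j, P.U_periodic j, P.contDiff_U (P.δ_pos hδ₀ (by rw [hd]; norm_num) j)⟩ P.γ))
    (hab : ∀ j, a (j + 1) = b j ∘ shearMap 1 0 (amp ⟨P.U j, P.U_periodic j, P.contDiff_U (P.δ_pos hδ₀ (by rw [hd]; norm_num) j)⟩ P.γ))
    {E₄ o₄ : ℝ} (ho₄ : 0 ≤ o₄)
    (hE₄ : ∑' k : Fin 2 → ℤ, (if |k 0| < ((500000 : ℕ) : ℤ) then (1 : ℝ) else 0) * ‖mFourierCoeff (fun x => (a 4 x : ℂ)) k‖ ^ 2 +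
        ∑' k : Fin 2 → ℤ, (if ((500000 : ℕ) : ℤ) ≤ |k 0| ∧ ((1 : ℕ) : ℤ) * |k 0| ≤ ((4 : ℕ) : ℤ) * |k 1| then (1 : ℝ) else 0) *
          ‖mFourierCoeff (fun x => (a 4 x : ℂ)) k‖ ^ 2 ≤ E₄)
    (ho : Real.sqrt (∑' k : Fin 2 → ℤ, (if ((500000 : ℕ) : ℤ) ≤ |k 0| ∧ ((1 : ℕ) : ℤ) * |k 0| ≤ ((4 : ℕ) : ℤ) * |k 1| then (1 : ℝ) else 0) *
          ‖mFourierCoeff (fun x => (a 4 x : ℂ)) k‖ ^ 2) ≤ o₄)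
    (hbudget : E₄ + 0.2488 * o₄ ≤ 0.348) :
    K1Localised P (P.γ ^ 2 - 3) := by
  obtain ⟨h11, o11⟩ := fat_segment_osc_le_11 P hγ hδ₀ (hδ₀'.trans (by norm_num)) hd hN₀ hρN a b has h0 hb hab ho₄ ho
  obtain ⟨h12, o12⟩ := junction_step_phase11 P hγ hδ₀ hδ₀' hd hN₀ hρN a b has h0 hb hab (o := 0.0036) (by norm_num) o11
  refine k1Localised_of_phase12 P hγ hδ₀ hδ₀' hd hN₀ hρN a b has h0 hb hab
    (B := E₄ + (0.1453 + 0.2488 * o₄) + (0.0032 + 0.0002 * 0.0036))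
    (h12.trans (add_le_add (h11.trans (add_le_add hE₄ (le_refl _))) (le_refl _))) o12 ?_
  rw [scalarL2Sq_datum]
  norm_num
  linarith [hbudget]

end Cascade

end Summit.AnomalousDissipation.AnomalousDissipation.Theorems.SawtoothPulseCascade.K1Window
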